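import Literature.NumberTheory.Automorphic.ArthurClozelBaseChange
import Literature.NumberTheory.Automorphic.Sweep1BaseChangeProofs
import Literature.NumberTheory.Automorphic.AutomorphicTwistSatake
import Literature.NumberTheory.Automorphic.UnramifiedHeckeScalarsFlathProofs
import Literature.NumberTheory.GaloisRepresentations.HeckeCharacterWeakApproximation
import HarnessLib

/-!
# Arthur–Clozel, Ch. 3, Thm. 4.2 (b): `π ≅ π ⊗ η` forces `ord(η) ∣ n` (proof file)

Topic `NumberTheory/Automorphic`; namespaces `Literature.NumberTheory.GaloisRepresentations.HeckeCharacter`, `Literature.Automorphic`, `Literature.Lang`.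
Sibling proof file of `ArthurClozelBaseChange` (faithful statements of Arthur–Clozel, Ch. 3,
Thm. 4.2 with the class-field character `η`). Everything here is **proved**:

* `Literature.NumberTheory.GaloisRepresentations.HeckeCharacter.exists_level_of_isFiniteOrder` — a Hecke character of finite order has a
  level: `χ ∘ det` is trivial on some principal congruence subgroup `K(𝔪)` of `GL_n(𝔸_K)`,
  `𝔪 ≠ 0` (the kernel of `χ` is open, `det` is continuous, and the `K(𝔪)` shrink to `1`,
  `exists_principalCongruenceLevel_subset`).
* `Literature.NumberTheory.Automorphic.CuspidalAutomorphicRepGL.pow_eq_one_of_twistByFiniteOrderChar_eq` — **if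
  `π ⊗ η = π` for a cuspidal `π` on `GL_n(𝔸_K)` and `η` of finite order, then `ηⁿ = 1`**
  (Arthur–Clozel, Ch. 3, p. 173 / proof of Thm. 4.2 (b): `π ≅ π ⊗ η` is only possible when the
  order of `η` divides `n`; classically by comparing central characters `ω_π = ω_π ηⁿ`). Proof
  here: at almost every place `v`, `η_v(ϖ_v)ⁿ = 1` by the Satake-parameter identity
  `t_{π ⊗ η, v} = η(ϖ_v) t_{π,v}` and `e_n(t_{π,v}) ≠ 0` (`pow_eq_one_of_twistByChar_eq` of
  `AutomorphicTwistSatake`, fed with the proved `Flath1979_heckeOperatorAt_ofLocal_eq_smul_holds`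
  and `exists_hasSatakeParameterAt_cofinite_holds`), so the Hecke character `ηⁿ` is `1` at almost
  all uniformizers, hence trivial by the rigidity of Hecke characters
  (`eq_one_of_eventually_valueAtUniformizer_eq_one`, i.e. weak approximation: `K^× 𝕀_K^S` is dense
  in `𝕀_K`); `orderOf_dvd_of_twistByFiniteOrderChar_eq` restates it as `ord(η) ∣ n`.
* `Literature.NumberTheory.Automorphic.IsClassFieldCharacter.orderOf_eq_finrank` — granted the class-field-theory fact
  `exists_isClassFieldCharacter` (some class-field character has order `[E : F]`), *every*
  class-field character of a cyclic `E/F` of prime degree has order `[E : F]` (all of them have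
  the same kernel `F^× N(𝔸_E^×)`).
* `Literature.NumberTheory.Automorphic.arthurClozel1989_dvd_of_twist_eq_of_classField` — **the named fact
  `ArthurClozel1989_dvd_of_twist_eq` (Thm. 4.2 (b), clause `ℓ ∣ n`) follows from class field
  theory alone** (`exists_isClassFieldCharacter`); and
  `Literature.NumberTheory.Automorphic.arthurClozel1989_exists_cuspidal_weakLift_or_dvd_of_weakLifting` — the dichotomy
  `ArthurClozel1989_exists_cuspidal_weakLift_or_dvd` behind lang.S23 now rests on Thm. 4.2 (a)
  (`ArthurClozel1989_weakLifting_cuspidal`), class field theory and multiplicity one over `F` only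
  (the input (b) of `arthurClozel1989_exists_cuspidal_weakLift_or_dvd_of_parts` being discharged).
* `Literature.NumberTheory.Automorphic.arthurClozel1989_dvd_of_twist_eq_of_normGroup_ne_top` — the same
  named fact from the *properness of the norm group* `normGroup F E ≠ ⊤` alone (the first
  inequality of class field theory, Tate, Ch. VII of Cassels–Fröhlich, §8, Consequence 8.4; named
  fact `Tate1967_firstInequality` of `NormGroupFirstInequality`), through
  `IsClassFieldCharacter.orderOf_eq_finrank_of_normGroup_ne_top`.

## References

* J. Arthur, L. Clozel, *Simple algebras, base change, and the advanced theory of the trace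
  formula*, Ann. of Math. Stud. 120 (1989), Ch. 3, §4, Thm. 4.2 (b) and p. 173. [ArthurClozelAMS120]
* J. W. S. Cassels, A. Fröhlich (eds.), *Algebraic Number Theory* (1967), Ch. VII (Tate), §4,
  Prop. 4.1 (proof: `K^* J_K^S` dense in `J_K`); §5.1 Main Theorem (B). [CasselsFrohlichANT1967]
* J. Tate, *Global class field theory*, Ch. VII of Cassels–Fröhlich (1967), §8, Consequence 8.4
  (the first inequality). [TateGCFT1967]
-/

noncomputable section

open scoped MatrixGroups
open NumberField IsDedekindDomain MeasureTheory Filter Topology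

/-! ### A finite-order Hecke character has a level -/

namespace Literature.NumberTheory.Automorphic
section HeckeCharacter
open Literature.NumberTheory.GaloisRepresentations (HeckeCharacter)
open Literature.NumberTheory.GaloisRepresentations.HeckeCharacter

open Automorphic

variable {K : Type} [Field K] [NumberField K]

/-- **A Hecke character of finite order has a level**: there is a non-zero ideal `𝔪 ⊆ 𝓞 K` with
`χ (det k) = 1` for all `k` in the principal congruence subgroup `K(𝔪) ≤ GL_n(𝔸_K)` (the kernel
of a finite-order `χ` is a neighbourhood of `1`, `ker_mem_nhds_of_isFiniteOrder`; `det` is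
continuous; the `K(𝔪)`, `𝔪 ≠ 0`, are cofinal among neighbourhoods of `1`,
`exists_principalCongruenceLevel_subset`). Ref: Neukirch, *Algebraic Number Theory*, Ch. VII §6,
after (6.11) (module of definition of a character of finite order). [folklore] -/
theorem _root_.Literature.NumberTheory.GaloisRepresentations.HeckeCharacter.exists_level_of_isFiniteOrder (n : ℕ) {χ : Literature.NumberTheory.GaloisRepresentations.HeckeCharacter K} (hχ : χ.IsFiniteOrder) :
    ∃ 𝔪 : Ideal (𝓞 K), 𝔪 ≠ 0 ∧
      ∀ k ∈ principalCongruenceLevel n K 𝔪, χ (Matrix.GeneralLinearGroup.det k) = 1 := by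
  have hker := ker_mem_nhds_of_isFiniteOrder hχ
  have hU : (Matrix.GeneralLinearGroup.det : GL (Fin n) (AdeleRing (𝓞 K) K) →* _) ⁻¹'
      {x : GaloisRepresentations.ideleGroup K | χ x = 1} ∈ 𝓝 (1 : GL (Fin n) (AdeleRing (𝓞 K) K)) :=
    Matrix.GeneralLinearGroup.continuous_det.continuousAt.preimage_mem_nhds
      (by rw [map_one]; exact hker)
  obtain ⟨𝔪, h𝔪, hsub⟩ := exists_principalCongruenceLevel_subset n K hU
  exact ⟨𝔪, h𝔪, fun k hk => hsub hk⟩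

end HeckeCharacter
end Literature.NumberTheory.Automorphic

/-! ### `π ⊗ η = π` forces `ηⁿ = 1` -/

namespace Literature.NumberTheory.Automorphic

namespace CuspidalAutomorphicRepGL

open AdelicGroupData

variable {n : ℕ} {K : Type} [Field K] [NumberField K] {μ : Measure (gl n K).automorphicQuotient}
  [(gl n K).IsAutomorphicMeasure μ]

/-- **`π ⊗ η = π` forces `ηⁿ = 1`** (Arthur–Clozel, Ch. 3, Thm. 4.2 (b) and p. 173: a cuspidal `π`
of `GL_n(𝔸_F)` with `π ≅ π ⊗ η`, `η` of order `ℓ`, is of the form described in (e), in particular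
`ℓ ∣ n`; the underlying elementary fact is `ηⁿ = 1`, classically `ω_{π ⊗ η} = ω_π ηⁿ`). Here for any
Hecke character `η` of finite order and cuspidal `π` on `GL_n(𝔸_K)` with `π ⊗ η = π` in `L²_cusp`
(any `n`; for `n = 0` the conclusion `η⁰ = 1` is empty): `η` has a level `𝔪` (`exists_level_of_isFiniteOrder`), `π` has Satake parameters at a
level `𝔫` at almost all `v` (`exists_hasSatakeParameterAt_cofinite_holds`), so at almost every `v`
`η_v(ϖ_v)ⁿ = 1` (`pow_eq_one_of_twistByChar_eq`, uniqueness of Satake parameters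
`Flath1979_heckeOperatorAt_ofLocal_eq_smul_holds`), i.e. the Hecke character `ηⁿ` (unramified almost
everywhere) is `1` at almost all uniformizers, hence `ηⁿ = 1`
(`HeckeCharacter.eq_one_of_eventually_valueAtUniformizer_eq_one`).
[cite: ArthurClozelAMS120, Ch. 3, Thm. 4.2 (b) (p. 173)] -/
theorem pow_eq_one_of_twistByFiniteOrderChar_eq (P : CuspidalAutomorphicRepGL n K μ)
    (η : Literature.NumberTheory.GaloisRepresentations.HeckeCharacter K) (hη : η.IsFiniteOrder) (heq : P.twistByFiniteOrderChar η hη = P) :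
    η ^ n = 1 := by
  classical
  obtain ⟨𝔪, h𝔪, hη𝔪⟩ := Literature.NumberTheory.GaloisRepresentations.HeckeCharacter.exists_level_of_isFiniteOrder n hη
  obtain ⟨𝔫, h𝔫, hsat⟩ := exists_hasSatakeParameterAt_cofinite_holds (n := n) (K := K) (μ := μ) P
  have hur : ∀ᶠ v : HeightOneSpectrum (𝓞 K) in cofinite, (η ^ n).IsUnramifiedAt v :=
    (η ^ n).finite_ramifiedPlaces_iff.1 (Literature.NumberTheory.GaloisRepresentations.HeckeCharacter.finite_ramifiedPlaces_holds (η ^ n))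
  have h𝔫' : ∀ᶠ v : HeightOneSpectrum (𝓞 K) in cofinite, ¬ v.asIdeal ∣ 𝔫 := by
    rw [Filter.eventually_cofinite]
    simpa only [not_not] using Ideal.finite_factors h𝔫
  have h𝔪' : ∀ᶠ v : HeightOneSpectrum (𝓞 K) in cofinite, ¬ v.asIdeal ∣ 𝔪 := by
    rw [Filter.eventually_cofinite]
    simpa only [not_not] using Ideal.finite_factors h𝔪
  refine Literature.NumberTheory.GaloisRepresentations.HeckeCharacter.eq_one_of_eventually_valueAtUniformizer_eq_one ?_
  filter_upwards [hsat, hur, h𝔫', h𝔪'] with v hv hvur hv𝔫 hv𝔪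
  obtain ⟨ϖ, α, hα⟩ := hv
  have hpow := P.pow_eq_one_of_twistByChar_eq Flath1979_heckeOperatorAt_ofLocal_eq_smul_holds η
    hη.isUnitary (fun t => Literature.NumberTheory.GaloisRepresentations.HeckeCharacter.map_posRealIdele_of_isFiniteOrder hη t) h𝔪 hη𝔪 heq
    h𝔫 hv𝔫 hv𝔪 hα
  rw [← Literature.NumberTheory.GaloisRepresentations.HeckeCharacter.localComponent_eq_valueAtUniformizer hvur hα.1,
    Literature.NumberTheory.GaloisRepresentations.HeckeCharacter.localComponent_apply, Literature.NumberTheory.GaloisRepresentations.HeckeCharacter.pow_apply, Units.val_pow_eq_pow_val]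
  exact hpow

/-- **`π ⊗ η = π` forces `ord(η) ∣ n`** (`η` of finite order, `π` cuspidal on `GL_n(𝔸_K)`; from
`pow_eq_one_of_twistByFiniteOrderChar_eq`). For `η` of prime order `ℓ` this is the clause
"`ℓ ∣ n`" of Arthur–Clozel, Ch. 3, Thm. 4.2 (b). [cite: ArthurClozelAMS120, Ch. 3, Thm. 4.2 (b) (p. 173)] -/
theorem orderOf_dvd_of_twistByFiniteOrderChar_eq (P : CuspidalAutomorphicRepGL n K μ)
    (η : Literature.NumberTheory.GaloisRepresentations.HeckeCharacter K) (hη : η.IsFiniteOrder) (heq : P.twistByFiniteOrderChar η hη = P) :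
    orderOf η ∣ n :=
  orderOf_dvd_of_pow_eq_one (P.pow_eq_one_of_twistByFiniteOrderChar_eq η hη heq)

end CuspidalAutomorphicRepGL

end Literature.NumberTheory.Automorphic

/-! ### Thm. 4.2 (b), clause `ℓ ∣ n`, from class field theory -/

namespace Literature.NumberTheory.Automorphic

open Automorphic AdelicGroupData

variable {n : ℕ} {F E : Type} [Field F] [NumberField F] [Field E] [NumberField E] [Algebra F E]
  [FiniteDimensional F E]

/-- **All class-field characters of a cyclic `E/F` have order `[E : F]`**, granted the
class-field-theory fact `exists_isClassFieldCharacter` (existence of one of order `[E : F]`): two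
class-field characters have the same kernel `F^× N(𝔸_E^×)`, so `η = 1` would force the one of
order `[E : F]` to be trivial; and `η^{[E:F]} = 1` (`IsTrivialOnNormGroup.pow_card`), so for
`[E : F]` prime the order is exactly `[E : F]`. (Cassels–Fröhlich, Ch. VII §5.1, Main Theorem (B):
`𝔸_F^×/F^× N(𝔸_E^×) ≅ Gal(E/F)`.) [cite: CasselsFrohlichANT1967, Ch. VII §5.1 Main Theorem (B)] -/
theorem IsClassFieldCharacter.orderOf_eq_finrank [IsGalois F E]
    (hCFT : exists_isClassFieldCharacter (F := F) (E := E)) (hℓ : (Module.finrank F E).Prime)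
    {η : Literature.NumberTheory.GaloisRepresentations.HeckeCharacter F} (hη : η.IsClassFieldCharacter E) : orderOf η = Module.finrank F E := by
  haveI : Fact (Module.finrank F E).Prime := ⟨hℓ⟩
  haveI : IsCyclic (E ≃ₐ[F] E) := isCyclic_of_prime_card (IsGalois.card_aut_eq_finrank F E)
  obtain ⟨η₀, hη₀, hord₀⟩ := hCFT
  -- `η ^ ℓ = 1`
  have hpow : η ^ Module.finrank F E = 1 := by
    have h := hη.isTrivialOnNormGroup.pow_card
    rwa [← Nat.card_eq_fintype_card, IsGalois.card_aut_eq_finrank] at h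
  have hdvd : orderOf η ∣ Module.finrank F E := orderOf_dvd_of_pow_eq_one hpow
  rcases (Nat.dvd_prime hℓ).1 hdvd with h1 | h1
  · -- `η = 1` would make the norm group everything, hence `η₀ = 1`
    exfalso
    have hη1 : η = 1 := orderOf_eq_one_iff.1 h1
    have hη₀1 : η₀ = 1 := Literature.NumberTheory.GaloisRepresentations.HeckeCharacter.ext fun x => by
      rw [Literature.NumberTheory.GaloisRepresentations.HeckeCharacter.one_apply]
      exact (hη₀ x).2 ((hη x).1 (by rw [hη1, Literature.NumberTheory.GaloisRepresentations.HeckeCharacter.one_apply]))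
    rw [hη₀1, orderOf_one] at hord₀
    exact hℓ.one_lt.ne hord₀
  · exact h1

/-- **Arthur–Clozel, Ch. 3, Thm. 4.2 (b), clause `ℓ ∣ n`, proved from class field theory**: the
named fact `ArthurClozel1989_dvd_of_twist_eq` (`π` cuspidal on `GL_n(𝔸_F)`, `n ≥ 1`, `π ⊗ η = π`
for a class-field character `η` of the cyclic extension `E/F` of prime degree `ℓ` ⇒ `ℓ ∣ n`) holds
as soon as class field theory supplies a class-field character of order `ℓ`
(`exists_isClassFieldCharacter`): `ord(η) ∣ n` unconditionally
(`orderOf_dvd_of_twistByFiniteOrderChar_eq`) and `ord(η) = ℓ`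
(`IsClassFieldCharacter.orderOf_eq_finrank`). [cite: ArthurClozelAMS120, Ch. 3, Thm. 4.2 (b) (p. 173)] -/
theorem arthurClozel1989_dvd_of_twist_eq_of_classField
    (hCFT : exists_isClassFieldCharacter (F := F) (E := E)) :
    ArthurClozel1989_dvd_of_twist_eq n F E := by
  intro _ _ hℓ η hη μ _ P hP
  rw [← IsClassFieldCharacter.orderOf_eq_finrank hCFT hℓ hη]
  exact P.orderOf_dvd_of_twistByFiniteOrderChar_eq η hη.isFiniteOrder hP

/-- **The dichotomy `ArthurClozel1989_exists_cuspidal_weakLift_or_dvd` behind lang.S23 from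
Thm. 4.2 (a), class field theory and multiplicity one over `F` only** (the input Thm. 4.2 (b) of
`arthurClozel1989_exists_cuspidal_weakLift_or_dvd_of_parts` is now the theorem
`arthurClozel1989_dvd_of_twist_eq_of_classField`). [cite: ArthurClozelAMS120, Ch. 3, Thm. 4.2 (a)–(b)] -/
theorem arthurClozel1989_exists_cuspidal_weakLift_or_dvd_of_weakLifting
    (hCFT : exists_isClassFieldCharacter (F := F) (E := E))
    (ha : ArthurClozel1989_weakLifting_cuspidal n F E)
    (hm : ∀ (μ : Measure (gl n F).automorphicQuotient) [(gl n F).IsAutomorphicMeasure μ],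
      multiplicity_one_gl n F μ) :
    ArthurClozel1989_exists_cuspidal_weakLift_or_dvd (n := n) (F := F) (E := E) :=
  arthurClozel1989_exists_cuspidal_weakLift_or_dvd_of_parts hCFT ha
    (arthurClozel1989_dvd_of_twist_eq_of_classField hCFT) hm

/-- **lang.S23 for `ℓ ∤ n` from Thm. 4.2 (a), class field theory and multiplicity one**: the
Langlands-list statement `exists_cuspidal_baseChange_of_not_dvd` (`Sweep1`) follows from
Arthur–Clozel's Thm. 4.2 (a) (`ArthurClozel1989_weakLifting_cuspidal`), the existence of the
class-field character (`exists_isClassFieldCharacter`) and multiplicity one on `GL_n` over `F`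
(`multiplicity_one_gl`), through `exists_cuspidal_baseChange_of_not_dvd_of_arthurClozel` of
`Sweep1BaseChangeProofs`. [cite: ArthurClozelAMS120, Ch. 3, Thm. 4.2 (a)] -/
theorem exists_cuspidal_baseChange_of_not_dvd_of_weakLifting
    (hCFT : exists_isClassFieldCharacter (F := F) (E := E))
    (ha : ArthurClozel1989_weakLifting_cuspidal n F E)
    (hm : ∀ (μ : Measure (gl n F).automorphicQuotient) [(gl n F).IsAutomorphicMeasure μ],
      multiplicity_one_gl n F μ) :
    exists_cuspidal_baseChange_of_not_dvd (n := n) (F := F) (E := E) :=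
  exists_cuspidal_baseChange_of_not_dvd_of_arthurClozel
    (arthurClozel1989_exists_cuspidal_weakLift_or_dvd_of_weakLifting hCFT ha hm)

end Literature.NumberTheory.Automorphic

/-! ### Thm. 4.2 (b), clause `ℓ ∣ n`, from the properness of the norm group alone

The class-field-theoretic input of `arthurClozel1989_dvd_of_twist_eq_of_classField` above is the
existence of a class-field character of order `[E : F]` (`exists_isClassFieldCharacter`, which
packages the reciprocity isomorphism `𝔸_F^×/F^× N(𝔸_E^×) ≅ Gal(E/F)`). Only a fragment of it is
used: that the norm group `F^× N(𝔸_E^×)` is a *proper* subgroup of `𝔸_F^×` — the first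
inequality of global class field theory (Tate, Ch. VII of Cassels–Fröhlich, §8, Consequence 8.4:
`[J_K : K^* N_{L/K} J_L] ≥ [L : K]` for `L/K` cyclic; vendored as the named fact
`Tate1967_firstInequality` of `NormGroupFirstInequality`). The two theorems below record the
reduction to exactly this fragment, as a hypothesis `normGroup F E ≠ ⊤` on the fixed pair
`(F, E)`, so that a discharge of the first inequality discharges `ArthurClozel1989_dvd_of_twist_eq`. -/

namespace Literature.NumberTheory.Automorphic

open Automorphic AdelicGroupData

variable {n : ℕ} {F E : Type} [Field F] [NumberField F] [Field E] [NumberField E] [Algebra F E]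
  [FiniteDimensional F E]

/-- **A class-field character of a prime-degree extension with proper norm group has order
`[E : F]`**: `η ^ [E:F] = 1` since `[E:F]`-th powers are norms (`IsTrivialOnNormGroup.pow_card`),
so `ord(η) ∈ {1, [E:F]}`, and `η = 1` would mean that *every* idele lies in `F^× N(𝔸_E^×)`
(`IsClassFieldCharacter.ne_one`). The hypothesis `normGroup F E ≠ ⊤` is the first inequality of
class field theory for the cyclic extension `E/F` (Tate, Ch. VII of Cassels–Fröhlich, §8,
Consequence 8.4). [cite: TateGCFT1967, §8 Consequence 8.4] -/
theorem IsClassFieldCharacter.orderOf_eq_finrank_of_normGroup_ne_top [IsGalois F E]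
    (hN : normGroup F E ≠ ⊤) (hℓ : (Module.finrank F E).Prime)
    {η : Literature.NumberTheory.GaloisRepresentations.HeckeCharacter F} (hη : η.IsClassFieldCharacter E) :
    orderOf η = Module.finrank F E := by
  haveI : Fact (Module.finrank F E).Prime := ⟨hℓ⟩
  haveI : IsCyclic (E ≃ₐ[F] E) := isCyclic_of_prime_card (IsGalois.card_aut_eq_finrank F E)
  have hpow : η ^ Module.finrank F E = 1 := by
    have h := hη.isTrivialOnNormGroup.pow_card
    rwa [← Nat.card_eq_fintype_card, IsGalois.card_aut_eq_finrank] at h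
  rcases (Nat.dvd_prime hℓ).1 (orderOf_dvd_of_pow_eq_one hpow) with h1 | h1
  · exfalso
    obtain ⟨x, hx⟩ : ∃ x : (AdeleRing (𝓞 F) F)ˣ, x ∉ normGroup F E := by
      by_contra h
      push Not at h
      exact hN ((Subgroup.eq_top_iff' _).2 h)
    exact hη.ne_one hx (orderOf_eq_one_iff.1 h1)
  · exact h1

/-- **Arthur–Clozel, Ch. 3, Thm. 4.2 (b), clause `ℓ ∣ n`, from the first inequality alone**: if the
norm group `F^× N(𝔸_E^×)` is a proper subgroup of `𝔸_F^×` (Tate, Ch. VII of Cassels–Fröhlich, §8,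
Consequence 8.4, for the cyclic extension `E/F` of prime degree `ℓ`), then every cuspidal `π` on
`GL_n(𝔸_F)`, `n ≥ 1`, with `π ⊗ η = π` for a class-field character `η` has `ℓ ∣ n`: `ord(η) ∣ n`
unconditionally (`orderOf_dvd_of_twistByFiniteOrderChar_eq`, p. 173: "`π ≅ π ⊗ η`" forces
`ηⁿ = 1`) and `ord(η) = ℓ` (`IsClassFieldCharacter.orderOf_eq_finrank_of_normGroup_ne_top`). With
`normGroup_ne_top_of_firstInequality` (`NormGroupFirstInequality`) this makes the named fact
`ArthurClozel1989_dvd_of_twist_eq n F E` a consequence of `Tate1967_firstInequality F E`.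
[cite: ArthurClozelAMS120, Ch. 3, Thm. 4.2 (b) (p. 173)] -/
theorem arthurClozel1989_dvd_of_twist_eq_of_normGroup_ne_top (hN : normGroup F E ≠ ⊤) :
    ArthurClozel1989_dvd_of_twist_eq n F E := by
  intro _ _ hℓ η hη μ _ P hP
  rw [← IsClassFieldCharacter.orderOf_eq_finrank_of_normGroup_ne_top hN hℓ hη]
  exact P.orderOf_dvd_of_twistByFiniteOrderChar_eq η hη.isFiniteOrder hP

end Literature.NumberTheory.Automorphic
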